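import Mathlib
import Literature.Combinatorics.Enumerative.AperyNumbers
import Literature.NumberTheory.Transcendental.AperyIrrationality
import Summits.KontsevichZagierPeriods.Zeta5Search.BrickBallTelescope
import Summits.KontsevichZagierPeriods.Zeta5Search.CalibrationAperyRecurrence
import Summits.KontsevichZagierPeriods.Zeta5Search.Certificates.Apery

/-!
# BrickBallApery — BALL'S SERIES IS APÉRY'S: `Σ_{k≥1} R_n^{(4,1,1)}(k) = b_n·ζ(3) − a_n` with Apéry's numbers
`b_n = Σ_k C(n,k)²C(n+k,k)²` and Apéry's second sequence `a_n`; hence THEOREM 10 at `(A,B) = (4,1)` CONTAINS the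
Apéry-number supercongruence `b_{np} ≡ b_n (mod p³)` (Gessel 1982) and gives `p^{3(L+1)}a_{np} ≡ p^{3L}a_n (mod p³)`
(cell zeta5-irr)

HONEST FRAMING: systematic search; no irrationality claim unless certified. INSTRUMENT theorem of the ζ(5)
census cell zeta5-irr (HOME `run/shared/lean/pub/zeta5-irr/`) — a CALIBRATION of the cell's 30-file brick chain against a
theorem in print. Source of the identification: W. Zudilin, *An elementary proof of Apéry's theorem*, math.NT/0202159
(2002) [held `paper:arxiv-math_0202159`]: Lemma 5 (the certificate, tree file `BrickBallTelescope`), Lemma 6 («summation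
of equalities (14) over t = 1, 2, … yields … = −S̃_n(1) … both functions (8) and (13) have zero at t = 1. Thus S̃_n(1) = 0
… and we obtain the desired recurrence (7) for the quantity (9)»), Lemma 7 («Since both F_n and F̃_n satisfy the same
second-order difference equation (7), we have to verify that F_0 = F̃_0 and F_1 = F̃_1 … F̃_0 = 2ζ(3) and F̃_1 =
10ζ(3) − 12») and the footnote hint («then v_n = u_nζ(3) − F_n also satisfies it»). The tree's kernel is Zudilin's
`R̃_n/2`, so every printed value is halved: `x_3(n) = b_n`, `x_0(n) = −a_n`. To separate the coefficient of `ζ(3)` from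
the constant term we use the tree's PROVED `Apery.irrational_zeta_three` (Apéry's theorem itself; no circularity — it
is an independent Literature proof) instead of the paper's coefficient bookkeeping. Nothing here is about ζ(5); no
denominator saving; 0 nats/n; rung F-Z1 NOT moved. Filed by the engine seat zi-eng (g11).

## What is PROVED (everything; standard axioms; no new definitions)

* `eq_zero_of_rat_lin_zetaThree` (`aζ(3) + b = 0`, `a, b ∈ ℚ` ⇒ `a = b = 0`);
* `linearForm_rec` — the linear forms `Φ_n = x_3(n)ζ(3) + x_0(n)` of `BrickLinearForms.hasSum_ball` satisfy Apéry's
  recurrence `(n+2)³Φ_{n+2} − (2n+3)(17(n+1)²+17(n+1)+5)Φ_{n+1} + (n+1)³Φ_n = 0` (telescoping `BrickBallTelescope.ball_telescope`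
  + `tendsto_ballCert` + uniqueness of limits); hence `xCoeff_three_rec`, `xZero_rec` (both coefficient sequences satisfy it);
* initial values from the series `Σ 1/k³ = ζ(3)` and `Σ R_1(k) = 5ζ(3) − 6`: `xCoeff_three_zero/one` (`1, 5`),
  `xZero_zero/one` (`0, −6`);
* **`xCoeff_three_eq_aperyNumber`** (`x_3(n) = b_n`, Literature `AperyNumbers.aperyNumber`), **`xCoeff_three_eq_qT`**
  (`= Apery.qT n n`, Rajkumar's table), hence `qT_diag_eq_aperyNumber` (the table diagonal IS the binomial sum — a link
  between two Literature objects not stated before), **`xZero_eq_neg_pT`** (`x_0(n) = −a_n = −Apery.pT n n`);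
  **`hasSum_ball_apery`**: `Σ_{k≥1} R_n(k) = b_nζ(3) − a_n` (Zudilin's Lemma 7, halved);
* COROLLARIES of THEOREM 10 (`BrickLinearForms.ball_congr`, every prime `p ≥ 5`): **`aperyNumber_modEq_mul_prime'`** —
  `b_{np} ≡ b_n (mod p³)` RE-DERIVED through the brick chain (the tree's `AperySupercongruences.aperyNumber_modEq_mul_prime`
  is Gessel's two-block proof; same statement, independent route); **`pT_congr`** — `v_p(p^{3(L+1)}a_{np} − p^{3L}a_n) ≥ 3`
  for `n < p^{L+1}`, and `pT_congr_log` with `L = ⌊log_p n⌋`: the companion supercongruence for Apéry's SECOND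
  (rational) sequence, for which the cell's literature pass (zi-lit, HOME LIT-ZI §21; zi-ref R5.5) found no printed statement.
-/

namespace Summit.KontsevichZagierPeriods.Zeta5Search.BrickBallApery

open Finset Nat Filter WithZero
open scoped Topology
open Literature.NumberTheory.Transcendental (zetaValue)
open Literature.NumberTheory.Transcendental.Apery (table qT pT H3 Boundary boundary_one boundary_H3 diag_succ
  table_zero_left H3_zero H3_succ irrational_zeta_three)
open Literature.NumberTheory.Transcendental.BallRivoal (harm hasSum_one_div_pow_shift)
open Literature.Combinatorics.Enumerative.AperyNumbers (aperyNumber aperyNumber_rec aperyNumber_zero aperyNumber_one)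
open Summit.KontsevichZagierPeriods.Zeta5Search.BrickKernelFrobenius (brickKernel)
open Summit.KontsevichZagierPeriods.Zeta5Search.BrickPartialFractions (xCoeff xZero)
open Summit.KontsevichZagierPeriods.Zeta5Search.BrickLinearForms (hasSum_ball cast_brickKernel ball_congr)
open Summit.KontsevichZagierPeriods.Zeta5Search.BrickBallTelescope (ballCert ball_telescope ballCert_one
  tendsto_ballCert cast_ballCert)
open Summit.KontsevichZagierPeriods.Zeta5Search.CalibrationAperyRecurrence (diag_rec)
open Summit.KontsevichZagierPeriods.Zeta5Search.Certificates.AperyReplay (qT_one_one)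

noncomputable section

/-! ## Separating the coefficient of `ζ(3)` (Apéry's theorem, from the tree) -/

/-- If `a·ζ(3) + b = 0` with rational `a, b`, then `a = 0` and `b = 0` — by the tree's `Apery.irrational_zeta_three`. -/
theorem eq_zero_of_rat_lin_zetaThree {a b : ℚ} (h : (a : ℝ) * zetaValue 3 + b = 0) : a = 0 ∧ b = 0 := by
  by_cases ha : a = 0
  · subst ha
    simp only [Rat.cast_zero, zero_mul, zero_add, Rat.cast_eq_zero] at h
    exact ⟨rfl, h⟩
  · exfalso
    have haR : (a : ℝ) ≠ 0 := by exact_mod_cast ha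
    refine irrational_zeta_three.ne_rat (-b / a) ?_
    push_cast
    field_simp
    linarith

/-! ## The linear forms satisfy Apéry's recurrence -/

/-- **Apéry's recurrence for Ball's linear forms** `Φ_n := x_3(n)ζ(3) + x_0(n) = Σ_{k≥1}R_n(k)`:
`(n+2)³Φ_{n+2} − (2n+3)(17(n+1)²+17(n+1)+5)Φ_{n+1} + (n+1)³Φ_n = 0` (Zudilin's Lemma 6, halved: sum the certificate
identity over `k`; the partial sums are `S_{n+1}(N+1) − S_{n+1}(1) = S_{n+1}(N+1) → 0`). -/
theorem linearForm_rec (n : ℕ) :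
    ((n : ℝ) + 2) ^ 3 * ((xCoeff 4 1 1 (n + 2) 3 : ℝ) * zetaValue 3 + (xZero 4 1 1 (n + 2) : ℝ))
      - (2 * ((n : ℝ) + 1) + 1) * (17 * ((n : ℝ) + 1) ^ 2 + 17 * ((n : ℝ) + 1) + 5) *
          ((xCoeff 4 1 1 (n + 1) 3 : ℝ) * zetaValue 3 + (xZero 4 1 1 (n + 1) : ℝ))
      + ((n : ℝ) + 1) ^ 3 * ((xCoeff 4 1 1 n 3 : ℝ) * zetaValue 3 + (xZero 4 1 1 n : ℝ)) = 0 := by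
  set s : ℕ → ℝ := fun k => ((ballCert (n + 1) ((k : ℚ) + 1) : ℚ) : ℝ) with hs
  -- the combination of the three convergent series
  have hG := (((hasSum_ball (n + 2)).mul_left (((n : ℝ) + 2) ^ 3)).sub
    ((hasSum_ball (n + 1)).mul_left ((2 * ((n : ℝ) + 1) + 1) * (17 * ((n : ℝ) + 1) ^ 2 + 17 * ((n : ℝ) + 1) + 5)))).add
    ((hasSum_ball n).mul_left (((n : ℝ) + 1) ^ 3))
  -- termwise it is the certificate difference
  have hterm : ∀ k : ℕ, ((n : ℝ) + 2) ^ 3 * brickKernel 4 1 1 (n + 2) ((k : ℝ) + 1)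
      - (2 * ((n : ℝ) + 1) + 1) * (17 * ((n : ℝ) + 1) ^ 2 + 17 * ((n : ℝ) + 1) + 5) * brickKernel 4 1 1 (n + 1) ((k : ℝ) + 1)
      + ((n : ℝ) + 1) ^ 3 * brickKernel 4 1 1 n ((k : ℝ) + 1) = s (k + 1) - s k := by
    intro k
    have h := congrArg (fun q : ℚ => (q : ℝ)) (ball_telescope n (t := (k : ℚ) + 1) (by positivity))
    simp only [hs] at h ⊢
    push_cast [cast_brickKernel, cast_ballCert] at h ⊢
    linear_combination h
  have hsum : ∀ N : ℕ, ∑ k ∈ range N, (s (k + 1) - s k) = s N := by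
    intro N
    rw [Finset.sum_range_sub, hs]
    simp only [Nat.cast_zero, zero_add, ballCert_one, Rat.cast_zero, sub_zero]
  have hlim := hG.tendsto_sum_nat
  simp_rw [hterm, hsum] at hlim
  have h0 : Tendsto s atTop (𝓝 0) := tendsto_ballCert n
  exact tendsto_nhds_unique hlim h0

/-- **`x_3` satisfies Apéry's recurrence**: `(n+2)³x_3(n+2) = (2n+3)(17(n+1)²+17(n+1)+5)x_3(n+1) − (n+1)³x_3(n)`. -/
theorem xCoeff_three_rec (n : ℕ) :
    ((n : ℚ) + 2) ^ 3 * xCoeff 4 1 1 (n + 2) 3 =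
      (2 * ((n : ℚ) + 1) + 1) * (17 * ((n : ℚ) + 1) ^ 2 + 17 * ((n : ℚ) + 1) + 5) * xCoeff 4 1 1 (n + 1) 3
        - ((n : ℚ) + 1) ^ 3 * xCoeff 4 1 1 n 3 := by
  have h := linearForm_rec n
  have key := eq_zero_of_rat_lin_zetaThree
    (a := ((n : ℚ) + 2) ^ 3 * xCoeff 4 1 1 (n + 2) 3
      - (2 * ((n : ℚ) + 1) + 1) * (17 * ((n : ℚ) + 1) ^ 2 + 17 * ((n : ℚ) + 1) + 5) * xCoeff 4 1 1 (n + 1) 3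
      + ((n : ℚ) + 1) ^ 3 * xCoeff 4 1 1 n 3)
    (b := ((n : ℚ) + 2) ^ 3 * xZero 4 1 1 (n + 2)
      - (2 * ((n : ℚ) + 1) + 1) * (17 * ((n : ℚ) + 1) ^ 2 + 17 * ((n : ℚ) + 1) + 5) * xZero 4 1 1 (n + 1)
      + ((n : ℚ) + 1) ^ 3 * xZero 4 1 1 n) (by push_cast; linear_combination h)
  linear_combination key.1

/-- **`x_0` satisfies Apéry's recurrence**: `(n+2)³x_0(n+2) = (2n+3)(17(n+1)²+17(n+1)+5)x_0(n+1) − (n+1)³x_0(n)`. -/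
theorem xZero_rec (n : ℕ) :
    ((n : ℚ) + 2) ^ 3 * xZero 4 1 1 (n + 2) =
      (2 * ((n : ℚ) + 1) + 1) * (17 * ((n : ℚ) + 1) ^ 2 + 17 * ((n : ℚ) + 1) + 5) * xZero 4 1 1 (n + 1)
        - ((n : ℚ) + 1) ^ 3 * xZero 4 1 1 n := by
  have h := linearForm_rec n
  have key := eq_zero_of_rat_lin_zetaThree
    (a := ((n : ℚ) + 2) ^ 3 * xCoeff 4 1 1 (n + 2) 3
      - (2 * ((n : ℚ) + 1) + 1) * (17 * ((n : ℚ) + 1) ^ 2 + 17 * ((n : ℚ) + 1) + 5) * xCoeff 4 1 1 (n + 1) 3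
      + ((n : ℚ) + 1) ^ 3 * xCoeff 4 1 1 n 3)
    (b := ((n : ℚ) + 2) ^ 3 * xZero 4 1 1 (n + 2)
      - (2 * ((n : ℚ) + 1) + 1) * (17 * ((n : ℚ) + 1) ^ 2 + 17 * ((n : ℚ) + 1) + 5) * xZero 4 1 1 (n + 1)
      + ((n : ℚ) + 1) ^ 3 * xZero 4 1 1 n) (by push_cast; linear_combination h)
  linear_combination key.2

/-! ## Initial values from the series -/

/-- `R_0(t) = 1/t³`. -/
theorem ballKernel_zero (t : ℝ) (ht : t ≠ 0) : brickKernel 4 1 1 0 t = 1 / t ^ 3 := by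
  unfold brickKernel
  simp only [Nat.factorial_zero, Nat.cast_one, one_pow, Nat.cast_zero, zero_div, add_zero, pow_one, one_mul,
    zero_add, Finset.range_one, Finset.prod_singleton]
  rw [show Finset.Icc 1 0 = (∅ : Finset ℕ) by decide]
  simp only [Finset.prod_empty, mul_one]
  field_simp

/-- **`x_3(0) = 1`, `x_0(0) = 0`** (from `Σ_{k≥1}1/k³ = ζ(3) = x_3(0)ζ(3) + x_0(0)` and Apéry's theorem). -/
theorem xCoeff_three_zero_and_xZero_zero : xCoeff 4 1 1 0 3 = 1 ∧ xZero 4 1 1 0 = 0 := by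
  have h1 := hasSum_ball 0
  have h2 : HasSum (fun k : ℕ => brickKernel 4 1 1 0 ((k : ℝ) + 1)) (zetaValue 3) := by
    have h := hasSum_one_div_pow_shift 3 0 (by norm_num)
    simp only [harm, Finset.range_zero, Finset.sum_empty, Rat.cast_zero, sub_zero, Nat.cast_zero, add_zero] at h
    have hfg : (fun k : ℕ => brickKernel 4 1 1 0 ((k : ℝ) + 1)) = fun k : ℕ => 1 / ((k : ℝ) + 1) ^ 3 :=
      funext fun k => ballKernel_zero _ (by positivity)
    rw [hfg]
    exact h
  have h := h1.unique h2
  have key := eq_zero_of_rat_lin_zetaThree (a := xCoeff 4 1 1 0 3 - 1) (b := xZero 4 1 1 0)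
    (by push_cast; linear_combination h)
  exact ⟨by linear_combination key.1, key.2⟩

/-- `R_1(t) = −1/t⁴ + 1/(t+1)⁴ + (5/2)(1/t³ + 1/(t+1)³) − (5/2)(1/t² − 1/(t+1)²)` for `t > 0` (Zudilin: `R̃_1 = −2/t⁴ +
2/(t+1)⁴ + 5/t³ + 5/(t+1)³ − 5/t² + 5/(t+1)²`, halved). -/
theorem ballKernel_one (t : ℝ) (ht : 0 < t) : brickKernel 4 1 1 1 t =
    -(1 / t ^ 4) + 1 / (t + 1) ^ 4 + 5 / 2 * (1 / t ^ 3) + 5 / 2 * (1 / (t + 1) ^ 3)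
      - 5 / 2 * (1 / t ^ 2) + 5 / 2 * (1 / (t + 1) ^ 2) := by
  unfold brickKernel
  simp only [Nat.factorial_one, Nat.cast_one, one_pow, pow_one, one_mul, Finset.Icc_self, Finset.prod_singleton,
    Finset.prod_range_succ, Finset.range_one, Nat.cast_zero, add_zero]
  have h1 : t + 1 ≠ 0 := by positivity
  field_simp
  ring

/-- **`x_3(1) = 5`, `x_0(1) = −6`** (from `Σ_{k≥1}R_1(k) = 5ζ(3) − 6` and Apéry's theorem; Zudilin: `F̃_1 = 10ζ(3) − 12`). -/
theorem xCoeff_three_one_and_xZero_one : xCoeff 4 1 1 1 3 = 5 ∧ xZero 4 1 1 1 = -6 := by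
  have h1 := hasSum_ball 1
  have e4 := hasSum_one_div_pow_shift 4 0 (by norm_num)
  have f4 := hasSum_one_div_pow_shift 4 1 (by norm_num)
  have e3 := hasSum_one_div_pow_shift 3 0 (by norm_num)
  have f3 := hasSum_one_div_pow_shift 3 1 (by norm_num)
  have e2 := hasSum_one_div_pow_shift 2 0 (by norm_num)
  have f2 := hasSum_one_div_pow_shift 2 1 (by norm_num)
  simp only [harm, Finset.range_zero, Finset.sum_empty, Rat.cast_zero, sub_zero, Nat.cast_zero, add_zero,
    Finset.range_one, Finset.sum_singleton, zero_add, one_pow, div_one, Rat.cast_one, Nat.cast_one] at e4 f4 e3 f3 e2 f2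
  have h2 := ((((e4.neg.add f4).add (e3.mul_left (5 / 2))).add (f3.mul_left (5 / 2))).sub (e2.mul_left (5 / 2))).add
    (f2.mul_left (5 / 2))
  have hfg : (fun k : ℕ => brickKernel 4 1 1 1 ((k : ℝ) + 1)) = fun k : ℕ =>
      -(1 / ((k : ℝ) + 1) ^ 4) + 1 / ((k : ℝ) + 1 + 1) ^ 4 + 5 / 2 * (1 / ((k : ℝ) + 1) ^ 3)
        + 5 / 2 * (1 / ((k : ℝ) + 1 + 1) ^ 3) - 5 / 2 * (1 / ((k : ℝ) + 1) ^ 2) + 5 / 2 * (1 / ((k : ℝ) + 1 + 1) ^ 2) :=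
    funext fun k => ballKernel_one _ (by positivity)
  have hv : -zetaValue 4 + (zetaValue 4 - 1) + 5 / 2 * zetaValue 3 + 5 / 2 * (zetaValue 3 - 1) - 5 / 2 * zetaValue 2
      + 5 / 2 * (zetaValue 2 - 1) = 5 * zetaValue 3 - 6 := by ring
  have h2' : HasSum (fun k : ℕ => brickKernel 4 1 1 1 ((k : ℝ) + 1)) (5 * zetaValue 3 - 6) := by
    rw [hfg, ← hv]
    exact h2
  have h := h1.unique h2'
  have key := eq_zero_of_rat_lin_zetaThree (a := xCoeff 4 1 1 1 3 - 5) (b := xZero 4 1 1 1 + 6)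
    (by push_cast; linear_combination h)
  exact ⟨by linear_combination key.1, by linear_combination key.2⟩

/-! ## Ball = Apéry -/

/-- **`x_3(n) = b_n`**: the `ζ(3)`-coefficient of Ball's series is the Apéry number `Σ_k C(n,k)²C(n+k,k)²`
(Literature `AperyNumbers.aperyNumber`; both satisfy Apéry's recurrence with the same two initial values). -/
theorem xCoeff_three_eq_aperyNumber (n : ℕ) : xCoeff 4 1 1 n 3 = (aperyNumber n : ℚ) := by
  have key : ∀ m, xCoeff 4 1 1 m 3 = (aperyNumber m : ℚ) ∧ xCoeff 4 1 1 (m + 1) 3 = (aperyNumber (m + 1) : ℚ) := by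
    intro m
    induction m with
    | zero =>
      rw [xCoeff_three_zero_and_xZero_zero.1, zero_add, xCoeff_three_one_and_xZero_one.1, aperyNumber_zero,
        aperyNumber_one]
      norm_num
    | succ m ih =>
      refine ⟨ih.2, ?_⟩
      have hx := xCoeff_three_rec m
      have hb := aperyNumber_rec m
      have hb' : ((m : ℚ) + 2) ^ 3 * (aperyNumber (m + 2) : ℚ) + ((m : ℚ) + 1) ^ 3 * (aperyNumber m : ℚ) =
          (2 * (m : ℚ) + 3) * (17 * (m : ℚ) ^ 2 + 51 * m + 39) * (aperyNumber (m + 1) : ℚ) := by exact_mod_cast hb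
      have hm : ((m : ℚ) + 2) ^ 3 ≠ 0 := by positivity
      apply mul_left_cancel₀ hm
      rw [show m + 1 + 1 = m + 2 by ring]
      linear_combination hx - hb' - ((m : ℚ) + 1) ^ 3 * ih.1 +
        (2 * ((m : ℚ) + 1) + 1) * (17 * ((m : ℚ) + 1) ^ 2 + 17 * ((m : ℚ) + 1) + 5) * ih.2
  exact (key n).1

/- `q_{1,1} = 5` is the tree's `Certificates.AperyReplay.qT_one_one`. -/

/-- `p_{1,1} = 6` in Rajkumar's table. -/
theorem pT_one_one : pT 1 1 = 6 := by
  show table H3 (0 + 1) (0 + 1) = 6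
  rw [diag_succ]
  simp only [table_zero_left, H3_succ, H3_zero]
  norm_num

/-- **`x_3(n) = q_{n,n}`**: the `ζ(3)`-coefficient of Ball's series is the diagonal of Apéry's table of denominators
(Literature `Apery.qT`, Rajkumar 2012). -/
theorem xCoeff_three_eq_qT (n : ℕ) : xCoeff 4 1 1 n 3 = qT n n := by
  have key : ∀ m, xCoeff 4 1 1 m 3 = qT m m ∧ xCoeff 4 1 1 (m + 1) 3 = qT (m + 1) (m + 1) := by
    intro m
    induction m with
    | zero =>
      rw [xCoeff_three_zero_and_xZero_zero.1, zero_add, xCoeff_three_one_and_xZero_one.1, qT_one_one]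
      simp
    | succ m ih =>
      refine ⟨ih.2, ?_⟩
      have hx := xCoeff_three_rec m
      have hq : ((m : ℚ) + 2) ^ 3 * qT (m + 2) (m + 2) = (34 * ((m : ℚ) + 1) ^ 3 + 51 * ((m : ℚ) + 1) ^ 2
          + 27 * ((m : ℚ) + 1) + 5) * qT (m + 1) (m + 1) - ((m : ℚ) + 1) ^ 3 * qT m m := diag_rec boundary_one m
      have hm : ((m : ℚ) + 2) ^ 3 ≠ 0 := by positivity
      apply mul_left_cancel₀ hm
      rw [show m + 1 + 1 = m + 2 by ring]
      linear_combination hx - hq - ((m : ℚ) + 1) ^ 3 * ih.1 +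
        (2 * ((m : ℚ) + 1) + 1) * (17 * ((m : ℚ) + 1) ^ 2 + 17 * ((m : ℚ) + 1) + 5) * ih.2
  exact (key n).1

/-- The diagonal of Rajkumar's table of denominators IS the binomial-sum Apéry sequence: `q_{n,n} = Σ_k C(n,k)²C(n+k,k)²`
(two Literature objects, linked through Ball's series). -/
theorem qT_diag_eq_aperyNumber (n : ℕ) : qT n n = (aperyNumber n : ℚ) := by
  rw [← xCoeff_three_eq_qT, xCoeff_three_eq_aperyNumber]

/-- **`x_0(n) = −a_n`**: the constant term of Ball's series is minus Apéry's second sequence, the diagonal of the table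
of numerators (Literature `Apery.pT`). -/
theorem xZero_eq_neg_pT (n : ℕ) : xZero 4 1 1 n = -pT n n := by
  have key : ∀ m, xZero 4 1 1 m = -pT m m ∧ xZero 4 1 1 (m + 1) = -pT (m + 1) (m + 1) := by
    intro m
    induction m with
    | zero =>
      rw [xCoeff_three_zero_and_xZero_zero.2, zero_add, xCoeff_three_one_and_xZero_one.2, pT_one_one]
      simp [H3_zero]
    | succ m ih =>
      refine ⟨ih.2, ?_⟩
      have hx := xZero_rec m
      have hq : ((m : ℚ) + 2) ^ 3 * pT (m + 2) (m + 2) = (34 * ((m : ℚ) + 1) ^ 3 + 51 * ((m : ℚ) + 1) ^ 2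
          + 27 * ((m : ℚ) + 1) + 5) * pT (m + 1) (m + 1) - ((m : ℚ) + 1) ^ 3 * pT m m := diag_rec boundary_H3 m
      have hm : ((m : ℚ) + 2) ^ 3 ≠ 0 := by positivity
      apply mul_left_cancel₀ hm
      rw [show m + 1 + 1 = m + 2 by ring]
      linear_combination hx + hq - ((m : ℚ) + 1) ^ 3 * ih.1 +
        (2 * ((m : ℚ) + 1) + 1) * (17 * ((m : ℚ) + 1) ^ 2 + 17 * ((m : ℚ) + 1) + 5) * ih.2
  exact (key n).1

/-- **BALL'S SERIES = APÉRY'S LINEAR FORM** (Zudilin's Lemma 7, halved): for every `n`,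
`Σ_{k≥1} n!²(k+n/2)(k−1)⋯(k−n)(k+n+1)⋯(k+2n)/(k⋯(k+n))⁴ = b_n·ζ(3) − a_n` with `b_n = q_{n,n}` the Apéry numbers and
`a_n = p_{n,n}` Apéry's second sequence (`a_n/b_n → ζ(3)`). -/
theorem hasSum_ball_apery (n : ℕ) :
    HasSum (fun k : ℕ => brickKernel 4 1 1 n ((k : ℝ) + 1)) ((aperyNumber n : ℝ) * zetaValue 3 - (pT n n : ℝ)) := by
  have h := hasSum_ball n
  rw [xCoeff_three_eq_aperyNumber, xZero_eq_neg_pT] at h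
  push_cast at h
  simpa only [sub_eq_add_neg] using h

/-! ## COROLLARIES of THEOREM 10 at `(A,B) = (4,1)`: the Apéry supercongruences -/

section supercongruence

variable {p : ℕ} [hp : Fact p.Prime]

/-- For an integer `z`: `v_p(z) ≤ exp(−k) ↔ p^k ∣ z`. [folklore] -/
theorem padicValuation_intCast_le_exp_neg_iff (z : ℤ) (k : ℕ) :
    Rat.padicValuation p (z : ℚ) ≤ exp (-(k : ℤ)) ↔ (p : ℤ) ^ k ∣ z := by
  rw [padicValInt_dvd_iff]
  by_cases hz : z = 0
  · subst hz; simp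
  · simp only [Rat.padicValuation, Valuation.coe_mk, MonoidWithZeroHom.coe_mk, ZeroHom.coe_mk,
      Rat.intCast_eq_zero_iff, hz, if_false, padicValRat.of_int, exp_le_exp, neg_le_neg_iff,
      Nat.cast_le, false_or]

/-- **Gessel's supercongruence `b_{np} ≡ b_n (mod p³)` RE-DERIVED from THEOREM 10** (p ≥ 5 prime, every n): the cell's
`s = 3` congruence `x_3(np) ≡ x_3(n) (mod p³)` for Ball's kernel (`BrickLinearForms.ball_congr`) read through
`x_3 = b_n`. Same statement as the Literature's `AperySupercongruences.aperyNumber_modEq_mul_prime` (Gessel 1982 Thm 3 (i),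
there by Gessel's two-block computation); here it falls out of the brick chain — a calibration of THEOREMS 6–10. -/
theorem aperyNumber_modEq_mul_prime' (h3 : 3 < p) (n : ℕ) :
    ((aperyNumber (n * p) : ℕ) : ℤ) ≡ (aperyNumber n : ℕ) [ZMOD (p : ℤ) ^ 3] := by
  have hn : n < p ^ (n + 1) :=
    calc n < 2 ^ n := Nat.lt_two_pow_self
      _ ≤ p ^ n := Nat.pow_le_pow_left hp.out.two_le n
      _ ≤ p ^ (n + 1) := Nat.pow_le_pow_right hp.out.pos (by omega)
  have h := (ball_congr h3 hn).1
  rw [xCoeff_three_eq_aperyNumber, xCoeff_three_eq_aperyNumber, ← Int.cast_natCast, ← Int.cast_natCast (aperyNumber n),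
    ← Int.cast_sub, show (-3 : ℤ) = -((3 : ℕ) : ℤ) by norm_num, padicValuation_intCast_le_exp_neg_iff] at h
  exact (Int.modEq_iff_dvd.2 h).symm

/-- **The companion supercongruence for Apéry's SECOND sequence** `a_n = p_{n,n}` (`a_n/b_n → ζ(3)`, `d_n³a_n ∈ ℤ`): for
every prime `p ≥ 5`, every `L` and every `n < p^{L+1}`: `v_p(p^{3(L+1)}a_{np} − p^{3L}a_n) ≥ 3`, i.e.
`p^{3(L+1)}a_{np} ≡ p^{3L}a_n (mod p³)` — THEOREM 10 (viii), harmonic cell, at `(A,B) = (4,1)`, read through `x_0 = −a_n`. -/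
theorem pT_congr (h3 : 3 < p) {L n : ℕ} (hn : n < p ^ (L + 1)) :
    Rat.padicValuation p ((p : ℚ) ^ (3 * (L + 1)) * pT (n * p) (n * p) - (p : ℚ) ^ (3 * L) * pT n n) ≤ exp (-3) := by
  have h := (ball_congr h3 hn).2
  rw [xZero_eq_neg_pT, xZero_eq_neg_pT, mul_neg, mul_neg, neg_sub_neg, Valuation.map_sub_swap] at h
  exact h

/-- The same at the natural level `L = ⌊log_p n⌋` (so `p^L ≤ n < p^{L+1}` for `n ≥ 1`): for every prime `p ≥ 5` and EVERY
`n`, `p^{3(⌊log_p n⌋+1)}·a_{np} ≡ p^{3⌊log_p n⌋}·a_n (mod p³)`. -/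
theorem pT_congr_log (h3 : 3 < p) (n : ℕ) :
    Rat.padicValuation p ((p : ℚ) ^ (3 * (Nat.log p n + 1)) * pT (n * p) (n * p)
      - (p : ℚ) ^ (3 * Nat.log p n) * pT n n) ≤ exp (-3) :=
  pT_congr h3 (Nat.lt_pow_succ_log_self hp.out.one_lt n)

end supercongruence

end

end Summit.KontsevichZagierPeriods.Zeta5Search.BrickBallApery
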